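import Summits.QuantumAdvantage.QuantumAdvantage.Theorems.SupportDialResidueCertificateD

/-! # SupportDial residue certificate — part E (decomp-qadv-lens-1 g7, node «ResidueDial» rev 5)

§7b part 1: the Y-contraction (index lemmas, `liftB`/`liftV`/`pz`, kernel and sign transfer, `rel_pull`). -/

set_option linter.dupNamespace false
set_option linter.style.longLine false
set_option linter.unusedVariables false

open Finset
open Literature.Computability.QuantumComplexity.RingHLF
open Literature.Computability.MetaComplexity.Smolensky (CubeFn mono lowDeg)
open Summit.QuantumAdvantage.AdviceFreeQNC0

namespace Summit.QuantumAdvantage.QuantumAdvantage.Theorems.SupportDialResidueCertificate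

/-! ## §7b `YStepLaw2` PROVED (0 sorry): the Y-contraction `C_k ← C_{k+1}`
Delete the vertex `v = Fin.last k` carrying `β_v = 1`, COMPLEMENT its two neighbours `u = k−1`, `0` (`liftB`), lift kernel
vectors by `v ↦ v'_u ⊕ v'_0` (`liftV`, `inKernel_lift`), pull answers back by `z'_l = z_l ⊕ [l ∈ {0,u}]·(z_v ⊕ β'_l)` (`pz`):
the odd class is preserved (`oddZeros_lift`), `⟨v',z'⟩ ≡ ⟨v,z⟩ + β'_u v'_u + β'_0 v'_0` (`dot_transfer`) and the sign bit moves by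
the same amount (`sign_transfer`, from the exact edge/overlap counts `edges_transfer`, `wt_transfer` and the evenness of `|x ∧ v|` on
kernel vectors, tree `RingHLF.even_wtAnd_of_inKernel`), so validity pulls back (`rel_pull`); the pulled-back strategy keeps 𝔽₂-degree
`≤ r` because the lift is coordinatewise affine (`comp_liftB_mem`, via the composition lemma `lowDeg_of_depends` of §6b) and the
correction `β'_l` has degree `1 ≤ r` (`pull_mem`).  All counts are handled as sums of `Bool.toNat` (no `Decidable` bookkeeping). -/
section YStep
open Literature.Computability.MetaComplexity.Smolensky

/-! ### Stage 1: ring indices of `C_{k+1}` seen from `C_k` (deleted vertex = `Fin.last k`) -/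

section Idx
variable {k : ℕ}

/-- ResidueDial helper `nxt_last` (lens-1 g7 ResidueDial certificate; see the enclosing section docstring). -/
theorem nxt_last (hk : 1 ≤ k) : nxt (Fin.last k) = Fin.castSucc (⟨0, by omega⟩ : Fin k) := by
  apply Fin.ext; simp [nxt, Fin.val_last]

/-- ResidueDial helper `prv_last` (lens-1 g7 ResidueDial certificate; see the enclosing section docstring). -/
theorem prv_last (hk : 1 ≤ k) : prv (Fin.last k) = Fin.castSucc (⟨k - 1, by omega⟩ : Fin k) := by
  apply Fin.ext
  simp only [prv, Fin.val_last, Fin.val_castSucc]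
  rw [show k + (k + 1) - 1 = (k - 1) + (k + 1) by omega, Nat.add_mod_right, Nat.mod_eq_of_lt (by omega)]

/-- ResidueDial helper `nxt_castSucc_of_lt` (lens-1 g7 ResidueDial certificate; see the enclosing section docstring). -/
theorem nxt_castSucc_of_lt (l : Fin k) (h : l.val + 1 < k) : nxt (Fin.castSucc l) = Fin.castSucc (nxt l) := by
  apply Fin.ext
  simp only [nxt, Fin.val_castSucc]
  rw [Nat.mod_eq_of_lt (by omega), Nat.mod_eq_of_lt h]

/-- ResidueDial helper `nxt_castSucc_of_eq` (lens-1 g7 ResidueDial certificate; see the enclosing section docstring). -/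
theorem nxt_castSucc_of_eq (l : Fin k) (h : l.val + 1 = k) : nxt (Fin.castSucc l) = Fin.last k := by
  apply Fin.ext
  simp only [nxt, Fin.val_castSucc, Fin.val_last]
  rw [h, Nat.mod_eq_of_lt (by omega)]

/-- ResidueDial helper `prv_castSucc_of_pos` (lens-1 g7 ResidueDial certificate; see the enclosing section docstring). -/
theorem prv_castSucc_of_pos (l : Fin k) (h : 0 < l.val) : prv (Fin.castSucc l) = Fin.castSucc (prv l) := by
  apply Fin.ext
  simp only [prv, Fin.val_castSucc]
  have hl := l.isLt
  rw [show l.val + (k + 1) - 1 = (l.val - 1) + (k + 1) by omega, Nat.add_mod_right, Nat.mod_eq_of_lt (by omega),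
    show l.val + k - 1 = (l.val - 1) + k by omega, Nat.add_mod_right, Nat.mod_eq_of_lt (by omega)]

/-- ResidueDial helper `prv_castSucc_of_zero` (lens-1 g7 ResidueDial certificate; see the enclosing section docstring). -/
theorem prv_castSucc_of_zero (l : Fin k) (h : l.val = 0) : prv (Fin.castSucc l) = Fin.last k := by
  apply Fin.ext
  simp only [prv, Fin.val_castSucc, Fin.val_last]
  rw [h, show 0 + (k + 1) - 1 = k by omega, Nat.mod_eq_of_lt (by omega)]

/-- ResidueDial helper `nxt_of_eq` (lens-1 g7 ResidueDial certificate; see the enclosing section docstring). -/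
theorem nxt_of_eq (l : Fin k) (h : l.val + 1 = k) : nxt l = ⟨0, by omega⟩ := by
  apply Fin.ext
  simp only [nxt]
  rw [h, Nat.mod_self]

/-- ResidueDial helper `prv_of_zero` (lens-1 g7 ResidueDial certificate; see the enclosing section docstring). -/
theorem prv_of_zero (l : Fin k) (h : l.val = 0) : prv l = ⟨k - 1, by omega⟩ := by
  apply Fin.ext
  simp only [prv]
  have hl := l.isLt
  rw [h, Nat.zero_add, Nat.mod_eq_of_lt (by omega)]

end Idx

/-! ### Stage 2: the lifts -/

section Lift
variable {k : ℕ}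

/-- the two neighbours `0`, `k−1` of the deleted vertex -/
def cN (l : Fin k) : Bool := decide (l.val = 0 ∨ l.val + 1 = k)

/-- lift a small-ring input: complement the two neighbours, put a `1` on the deleted vertex -/
def liftB (β' : Fin k → Bool) : Fin (k + 1) → Bool := Fin.snoc (fun l => xor (β' l) (cN l)) true

/-- lift a small-ring kernel vector: the deleted vertex carries `v'_{k−1} ⊕ v'_0` -/
def liftV (v' : Fin k → Bool) (u0 : Bool) : Fin (k + 1) → Bool := Fin.snoc v' u0

/-- pull a big-ring answer back: `z'_l = z_l ⊕ [l ∈ {0,k−1}]·(z_last ⊕ β'_l)` -/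
def pz (z : Fin (k + 1) → Bool) (β' : Fin k → Bool) : Fin k → Bool :=
  fun l => xor (z (Fin.castSucc l)) (cN l && xor (z (Fin.last k)) (β' l))

/-- ResidueDial helper `liftB_castSucc` (lens-1 g7 ResidueDial certificate; see the enclosing section docstring). -/
@[simp] theorem liftB_castSucc (β' : Fin k → Bool) (l : Fin k) : liftB β' (Fin.castSucc l) = xor (β' l) (cN l) := by
  unfold liftB; exact Fin.snoc_castSucc (α := fun _ => Bool) _ _ _
/-- ResidueDial helper `liftB_last` (lens-1 g7 ResidueDial certificate; see the enclosing section docstring). -/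
@[simp] theorem liftB_last (β' : Fin k → Bool) : liftB β' (Fin.last k) = true := by
  unfold liftB; exact Fin.snoc_last (α := fun _ => Bool) _ _
/-- ResidueDial helper `liftV_castSucc` (lens-1 g7 ResidueDial certificate; see the enclosing section docstring). -/
@[simp] theorem liftV_castSucc (v' : Fin k → Bool) (u0 : Bool) (l : Fin k) : liftV v' u0 (Fin.castSucc l) = v' l := by
  unfold liftV; exact Fin.snoc_castSucc (α := fun _ => Bool) _ _ _
/-- ResidueDial helper `liftV_last` (lens-1 g7 ResidueDial certificate; see the enclosing section docstring). -/
@[simp] theorem liftV_last (v' : Fin k → Bool) (u0 : Bool) : liftV v' u0 (Fin.last k) = u0 := by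
  unfold liftV; exact Fin.snoc_last (α := fun _ => Bool) _ _

/-- (L3) kernel transfer. -/
theorem inKernel_lift (hk : 3 ≤ k) (β' v' : Fin k → Bool) (hv : InKernel β' v') :
    InKernel (liftB β') (liftV v' (xor (v' ⟨k - 1, by omega⟩) (v' ⟨0, by omega⟩))) := by
  intro b
  induction b using Fin.lastCases with
  | last =>
    rw [nxt_last (by omega), prv_last (by omega)]
    simp only [liftV_castSucc, liftV_last, liftB_last, Bool.true_and]
    cases v' ⟨k - 1, _⟩ <;> cases v' ⟨0, _⟩ <;> rfl
  | cast l =>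
    have hl := l.isLt
    have hvl := hv l
    simp only [liftB_castSucc, cN]
    by_cases h0 : l.val = 0
    · -- neighbour 0
      have hlz : l = ⟨0, by omega⟩ := Fin.ext h0
      rw [hlz] at hvl ⊢
      rw [prv_castSucc_of_zero _ rfl, nxt_castSucc_of_lt _ (by simp only; omega), liftV_last, liftV_castSucc,
        liftV_castSucc]
      rw [prv_of_zero _ rfl] at hvl
      simp only [true_or, decide_true, Bool.xor_true]
      revert hvl
      generalize v' ⟨k - 1, by omega⟩ = A
      generalize v' ⟨0, by omega⟩ = B
      generalize v' (nxt ⟨0, by omega⟩) = C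
      generalize β' ⟨0, by omega⟩ = D
      cases A <;> cases B <;> cases C <;> cases D <;> decide
    · by_cases hu : l.val + 1 = k
      · have hlu : l = ⟨k - 1, by omega⟩ := Fin.ext (by simp only; omega)
        rw [hlu] at hvl ⊢
        rw [nxt_castSucc_of_eq _ (by simp only; omega), prv_castSucc_of_pos _ (by simp only; omega), liftV_last,
          liftV_castSucc, liftV_castSucc]
        rw [nxt_of_eq _ (by simp only; omega)] at hvl
        have hc : decide ((⟨k - 1, by omega⟩ : Fin k).val = 0 ∨ (⟨k - 1, by omega⟩ : Fin k).val + 1 = k) = true := by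
          simp only [decide_eq_true_eq]; omega
        rw [hc, Bool.xor_true]
        revert hvl
        generalize v' ⟨k - 1, by omega⟩ = A
        generalize v' ⟨0, by omega⟩ = B
        generalize v' (prv ⟨k - 1, by omega⟩) = C
        generalize β' ⟨k - 1, by omega⟩ = D
        cases A <;> cases B <;> cases C <;> cases D <;> decide
      · rw [nxt_castSucc_of_lt l (by omega), prv_castSucc_of_pos l (by omega), liftV_castSucc, liftV_castSucc,
          liftV_castSucc]
        have hc : decide (l.val = 0 ∨ l.val + 1 = k) = false := by simp [h0, hu]
        rw [hc, Bool.xor_false]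
        exact hvl

/-- the neighbour set has exactly two elements (`k ≥ 2`). -/
theorem filter_cN (hk : 2 ≤ k) : (univ.filter fun l : Fin k => cN l = true) = {⟨0, by omega⟩, ⟨k - 1, by omega⟩} := by
  ext l
  simp only [cN, Finset.mem_filter, Finset.mem_univ, true_and, decide_eq_true_eq, Finset.mem_insert,
    Finset.mem_singleton, Fin.ext_iff]
  omega

/-- ResidueDial helper `sum_cN` (lens-1 g7 ResidueDial certificate; see the enclosing section docstring). -/
theorem sum_cN (hk : 2 ≤ k) (g : Fin k → ℕ) :
    (∑ l : Fin k, if cN l = true then g l else 0) = g ⟨0, by omega⟩ + g ⟨k - 1, by omega⟩ := by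
  rw [← Finset.sum_filter, filter_cN hk, Finset.sum_pair]
  exact fun h => by simp [Fin.ext_iff] at h; omega

/-- (L2) the lift stays in the odd class. -/
theorem oddZeros_lift (hk : 2 ≤ k) (β' : Fin k → Bool) (h : OddZeros β') : OddZeros (liftB β') := by
  unfold OddZeros at h ⊢
  rw [Finset.card_filter, Fin.sum_univ_castSucc, liftB_last]
  simp only [liftB_castSucc]
  rw [Finset.card_filter] at h
  have hpt : ∀ l : Fin k, (if (xor (β' l) (cN l)) = false then 1 else 0 : ℕ) % 2 =
      ((if β' l = false then 1 else 0 : ℕ) + (if cN l = true then 1 else 0)) % 2 := by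
    intro l; cases β' l <;> cases cN l <;> rfl
  rw [Nat.add_mod, Finset.sum_nat_mod, Finset.sum_congr rfl fun l _ => hpt l, ← Finset.sum_nat_mod,
    Finset.sum_add_distrib, sum_cN hk]
  simp only [Bool.true_eq_false, ite_false]
  omega

end Lift

/-! ### Stage 3: answer and sign transfer (all counts as sums of `Bool.toNat`, no `Decidable` bookkeeping) -/

section Transfer
variable {k : ℕ}

/-- ResidueDial helper `card_filter_and` (lens-1 g7 ResidueDial certificate; see the enclosing section docstring). -/
theorem card_filter_and {n : ℕ} (f g : Fin n → Bool) :
    (univ.filter fun b : Fin n => f b = true ∧ g b = true).card = ∑ b : Fin n, (f b && g b).toNat := by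
  rw [Finset.card_filter]
  exact Finset.sum_congr rfl fun b _ => by cases f b <;> cases g b <;> rfl

/-- ResidueDial helper `dot2_eq` (lens-1 g7 ResidueDial certificate; see the enclosing section docstring). -/
theorem dot2_eq {n : ℕ} (v z : Fin n → Bool) : dot2 v z = (∑ b : Fin n, (v b && z b).toNat) % 2 := by
  unfold dot2; rw [card_filter_and]

/-- ResidueDial helper `edgesIn_eq` (lens-1 g7 ResidueDial certificate; see the enclosing section docstring). -/
theorem edgesIn_eq {n : ℕ} (v : Fin n → Bool) : edgesIn v = ∑ b : Fin n, (v b && v (nxt b)).toNat := by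
  unfold edgesIn; rw [card_filter_and]

/-- ResidueDial helper `wtAnd_eq` (lens-1 g7 ResidueDial certificate; see the enclosing section docstring). -/
theorem wtAnd_eq {n : ℕ} (x v : Fin n → Bool) : wtAnd x v = ∑ b : Fin n, (x b && v b).toNat := by
  unfold wtAnd; rw [card_filter_and]

/-- ResidueDial helper `sum_cN_toNat` (lens-1 g7 ResidueDial certificate; see the enclosing section docstring). -/
theorem sum_cN_toNat (hk : 2 ≤ k) (g : Fin k → Bool) :
    (∑ l : Fin k, (cN l && g l).toNat) = (g ⟨0, by omega⟩).toNat + (g ⟨k - 1, by omega⟩).toNat := by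
  rw [← sum_cN hk (fun l => (g l).toNat)]
  exact Finset.sum_congr rfl fun l _ => by cases cN l <;> cases g l <;> rfl

/-- (D) `⟨v', z'⟩ ≡ ⟨v, z⟩ + β'_u v'_u + β'_0 v'_0`. -/
theorem dot_transfer (hk : 2 ≤ k) (v' β' : Fin k → Bool) (z : Fin (k + 1) → Bool) :
    dot2 v' (pz z β') =
      (dot2 (liftV v' (xor (v' ⟨k - 1, by omega⟩) (v' ⟨0, by omega⟩))) z +
        (β' ⟨k - 1, by omega⟩ && v' ⟨k - 1, by omega⟩).toNat + (β' ⟨0, by omega⟩ && v' ⟨0, by omega⟩).toNat) % 2 := by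
  rw [dot2_eq, dot2_eq, Fin.sum_univ_castSucc, liftV_last]
  simp only [liftV_castSucc]
  have hpt : ∀ l : Fin k, (v' l && pz z β' l).toNat % 2 =
      ((v' l && z (Fin.castSucc l)).toNat + (cN l && ((v' l && z (Fin.last k)) ^^ (v' l && β' l))).toNat) % 2 := by
    intro l; unfold pz
    cases v' l <;> cases z (Fin.castSucc l) <;> cases cN l <;> cases z (Fin.last k) <;> cases β' l <;> rfl
  have hpt2 : ∀ l : Fin k, (cN l && ((v' l && z (Fin.last k)) ^^ (v' l && β' l))).toNat % 2 =
      ((cN l && (v' l && z (Fin.last k))).toNat + (cN l && (v' l && β' l)).toNat) % 2 := by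
    intro l; cases v' l <;> cases cN l <;> cases z (Fin.last k) <;> cases β' l <;> rfl
  have hC : (∑ l : Fin k, (cN l && ((v' l && z (Fin.last k)) ^^ (v' l && β' l))).toNat) % 2 =
      (((v' ⟨0, by omega⟩ && z (Fin.last k))).toNat + ((v' ⟨k - 1, by omega⟩ && z (Fin.last k))).toNat +
        (((v' ⟨0, by omega⟩ && β' ⟨0, by omega⟩)).toNat + ((v' ⟨k - 1, by omega⟩ && β' ⟨k - 1, by omega⟩)).toNat)) % 2 := by
    rw [Finset.sum_nat_mod, Finset.sum_congr rfl fun l _ => hpt2 l, ← Finset.sum_nat_mod, Finset.sum_add_distrib,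
      sum_cN_toNat hk, sum_cN_toNat hk]
  rw [Finset.sum_nat_mod, Finset.sum_congr rfl fun l _ => hpt l, ← Finset.sum_nat_mod, Finset.sum_add_distrib,
    Nat.add_mod, hC]
  generalize (∑ l : Fin k, (v' l && z (Fin.castSucc l)).toNat) = N
  generalize v' ⟨k - 1, by omega⟩ = vU
  generalize v' ⟨0, by omega⟩ = vZ
  generalize β' ⟨k - 1, by omega⟩ = bU
  generalize β' ⟨0, by omega⟩ = bZ
  cases vU <;> cases vZ <;> cases bU <;> cases bZ <;> cases z (Fin.last k) <;> simp <;> omega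

/-- (E) edge count of the lift. -/
theorem edges_transfer (hk : 2 ≤ k) (v' : Fin k → Bool) (x : Bool) :
    edgesIn (liftV v' x) + (v' ⟨k - 1, by omega⟩ && v' ⟨0, by omega⟩).toNat =
      edgesIn v' + (v' ⟨k - 1, by omega⟩ && x).toNat + (x && v' ⟨0, by omega⟩).toNat := by
  rw [edgesIn_eq, edgesIn_eq, Fin.sum_univ_castSucc, nxt_last (by omega), liftV_last, liftV_castSucc]
  simp only [liftV_castSucc]
  have hpt : ∀ l : Fin k, (v' l && liftV v' x (nxt (Fin.castSucc l))).toNat +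
      (decide (l = ⟨k - 1, by omega⟩) && (v' ⟨k - 1, by omega⟩ && v' ⟨0, by omega⟩)).toNat =
      (v' l && v' (nxt l)).toNat + (decide (l = ⟨k - 1, by omega⟩) && (v' ⟨k - 1, by omega⟩ && x)).toNat := by
    intro l
    by_cases hu : l = ⟨k - 1, by omega⟩
    · rw [hu, nxt_castSucc_of_eq _ (by simp only; omega), liftV_last, nxt_of_eq _ (by simp only; omega), decide_eq_true rfl]
      cases v' ⟨k - 1, _⟩ <;> cases v' ⟨0, _⟩ <;> cases x <;> rfl
    · have hl : l.val + 1 < k := by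
        have := l.isLt
        have hne : l.val ≠ k - 1 := fun h => hu (Fin.ext (by simp only; omega))
        omega
      rw [nxt_castSucc_of_lt l hl, liftV_castSucc, decide_eq_false hu]
      cases v' l <;> cases v' (nxt l) <;> rfl
  have hsum := Finset.sum_congr rfl fun l (_ : l ∈ (univ : Finset (Fin k))) => hpt l
  rw [Finset.sum_add_distrib, Finset.sum_add_distrib] at hsum
  have hδ : ∀ c : Bool, (∑ l : Fin k, (decide (l = ⟨k - 1, by omega⟩) && c).toNat) = c.toNat := by
    intro c
    rw [Finset.sum_eq_single (⟨k - 1, by omega⟩ : Fin k)]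
    · rw [decide_eq_true rfl]; cases c <;> rfl
    · intro l _ hl; rw [decide_eq_false hl]; rfl
    · intro h; exact absurd (Finset.mem_univ _) h
  rw [hδ, hδ] at hsum
  generalize (∑ l : Fin k, (v' l && liftV v' x (nxt (Fin.castSucc l))).toNat) = A at hsum ⊢
  generalize (∑ l : Fin k, (v' l && v' (nxt l)).toNat) = B at hsum ⊢
  generalize v' ⟨k - 1, by omega⟩ = vU at hsum ⊢
  generalize v' ⟨0, by omega⟩ = vZ at hsum ⊢
  cases vU <;> cases vZ <;> cases x <;> simp at hsum ⊢ <;> omega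

/-- (W) overlap count of the lift. -/
theorem wt_transfer (hk : 2 ≤ k) (β' v' : Fin k → Bool) (x : Bool) :
    wtAnd (liftB β') (liftV v' x) + (β' ⟨0, by omega⟩ && v' ⟨0, by omega⟩).toNat +
        (β' ⟨k - 1, by omega⟩ && v' ⟨k - 1, by omega⟩).toNat =
      wtAnd β' v' + (!β' ⟨0, by omega⟩ && v' ⟨0, by omega⟩).toNat +
        (!β' ⟨k - 1, by omega⟩ && v' ⟨k - 1, by omega⟩).toNat + x.toNat := by
  rw [wtAnd_eq, wtAnd_eq, Fin.sum_univ_castSucc, liftB_last, liftV_last]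
  simp only [liftB_castSucc, liftV_castSucc, Bool.true_and]
  have hpt : ∀ l : Fin k, ((β' l ^^ cN l) && v' l).toNat + (cN l && (β' l && v' l)).toNat =
      (β' l && v' l).toNat + (cN l && (!β' l && v' l)).toNat := by
    intro l; cases β' l <;> cases cN l <;> cases v' l <;> rfl
  have hsum := Finset.sum_congr rfl fun l (_ : l ∈ (univ : Finset (Fin k))) => hpt l
  rw [Finset.sum_add_distrib, Finset.sum_add_distrib, sum_cN_toNat hk, sum_cN_toNat hk] at hsum
  generalize (∑ l : Fin k, ((β' l ^^ cN l) && v' l).toNat) = A at hsum ⊢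
  generalize (∑ l : Fin k, (β' l && v' l).toNat) = B at hsum ⊢
  generalize v' ⟨k - 1, by omega⟩ = vU at hsum ⊢
  generalize v' ⟨0, by omega⟩ = vZ at hsum ⊢
  generalize β' ⟨k - 1, by omega⟩ = bU at hsum ⊢
  generalize β' ⟨0, by omega⟩ = bZ at hsum ⊢
  cases vU <;> cases vZ <;> cases bU <;> cases bZ <;> cases x <;> simp at hsum ⊢ <;> omega

/-- (S) sign transfer on kernel vectors: `s₁ + β'_u v'_u + β'_0 v'_0 ≡ s₀`. -/
theorem sign_transfer (hk : 3 ≤ k) (β' v' : Fin k → Bool) (hv : InKernel β' v') :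
    (signBit (liftB β') (liftV v' (xor (v' ⟨k - 1, by omega⟩) (v' ⟨0, by omega⟩))) +
        (β' ⟨k - 1, by omega⟩ && v' ⟨k - 1, by omega⟩).toNat + (β' ⟨0, by omega⟩ && v' ⟨0, by omega⟩).toNat) % 2 =
      signBit β' v' := by
  obtain ⟨a, ha⟩ := even_wtAnd_of_inKernel hv
  obtain ⟨b, hb⟩ := even_wtAnd_of_inKernel (inKernel_lift hk β' v' hv)
  have hE := edges_transfer (by omega : 2 ≤ k) v' (xor (v' ⟨k - 1, by omega⟩) (v' ⟨0, by omega⟩))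
  have hW := wt_transfer (by omega : 2 ≤ k) β' v' (xor (v' ⟨k - 1, by omega⟩) (v' ⟨0, by omega⟩))
  unfold signBit
  generalize wtAnd (liftB β') (liftV v' (xor (v' ⟨k - 1, by omega⟩) (v' ⟨0, by omega⟩))) = w₁ at hb hW ⊢
  generalize edgesIn (liftV v' (xor (v' ⟨k - 1, by omega⟩) (v' ⟨0, by omega⟩))) = e₁ at hE ⊢
  generalize wtAnd β' v' = w₀ at ha hW ⊢
  generalize edgesIn v' = e₀ at hE ⊢
  generalize v' ⟨k - 1, by omega⟩ = vU at hE hW ⊢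
  generalize v' ⟨0, by omega⟩ = vZ at hE hW ⊢
  generalize β' ⟨k - 1, by omega⟩ = bU at hE hW ⊢
  generalize β' ⟨0, by omega⟩ = bZ at hE hW ⊢
  cases vU <;> cases vZ <;> cases bU <;> cases bZ <;> simp at hE hW ⊢ <;> omega

/-- (R) the pulled-back answer inherits validity: `Rel (liftB β') z → Rel β' (pz z β')`. -/
theorem rel_pull (hk : 3 ≤ k) (β' : Fin k → Bool) (z : Fin (k + 1) → Bool) (hz : Rel (liftB β') z) :
    Rel β' (pz z β') := by
  intro v' hv'
  have hbig := hz _ (inKernel_lift hk β' v' hv')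
  rw [dot_transfer (by omega) v' β' z, hbig]
  exact sign_transfer hk β' v' hv'

end Transfer
end YStep

end Summit.QuantumAdvantage.QuantumAdvantage.Theorems.SupportDialResidueCertificate
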